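import Literature.Probability.LatticeModels.RandomClusterEdgeWeights
import Literature.Probability.LatticeModels.ProdBernoulliWeightContinuity
import HarnessLib

/-!
# Continuity of the edge-parameter random-cluster probabilities in the parameters, and the closure principle

Topic `Literature/Probability/LatticeModels`; companion of `RandomClusterEdgeWeights.lean` (`φ^B_{𝐩,q} = rcMeasureW w q B`, Grimmett
2006, eq. (1.20)) and the FK counterpart of `ProdBernoulliWeightContinuity.lean`.  For a finite vertex type and fixed `q > 0`:

* `rcWeightW_continuous`, `rcPartitionFunctionW_continuous`, `rcMeasureW_real_continuous` — `𝐩 ↦ φ^B_{𝐩,q}(A)` is continuous on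
  `Sym2 V → [0,1]` for every event `A`: it is a rational function of the parameters with positive denominator `Z` (Grimmett 2006,
  Thm. (4.63)/§4.5: finite-volume random-cluster probabilities are ratios of polynomials in `p`, hence smooth; here with one variable per
  edge).
* `rcMeasureW_real_pos_of_nonempty` — for non-degenerate parameters (`0 < p_e < 1`) every nonempty event has positive probability
  (finite energy, Grimmett 2006, (3.4)).
* closure principle: with these, `weights_le_of_forall_pos_lt_one` (`ProdBernoulliWeightContinuity.lean`, index type `Sym2 V`) extends
  an inequality between continuous functions of the parameters from non-degenerate `𝐩` (`0 < p_e < 1`, e.g. the standing hypothesis of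
  van den Berg–Häggström–Kahn 2006 §2.1) to all `𝐩 ∈ [0,1]^E`.

## References

* G. Grimmett, *The Random-Cluster Model*, Springer 2006: eq. (1.20); (3.4) (finite energy); Thm. (4.63) and §4.5 (smoothness of
  finite-volume quantities in `p`).
-/

noncomputable section

open MeasureTheory Finset
open scoped ENNReal Classical
open _root_.Topology

namespace Literature.Probability.LatticeModels

open Literature.Probability.Percolation (BondConfig)
open Literature.Probability.Percolation.BHK2006 (weight weight_nonneg)
open Literature.Probability.Percolation.DecisionTree (ind ind_of_mem ind_of_not_mem ind_nonneg)

section Continuity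

variable {V : Type*} [Fintype V]

/-- The product weight of a fixed configuration is continuous in the parameters. [cite: Grimmett2006, §4.5 (Thm. (4.63))] -/
theorem weight_continuous (ω : BondConfig V) :
    Continuous fun w : Sym2 V → unitInterval => weight (fun e => (w e : ℝ)) ω := by
  unfold weight
  refine continuous_finsetProd _ fun e _ => ?_
  by_cases he : e ∈ ω
  · simp only [he, if_true]; exact continuous_coe_weight_apply e
  · simp only [he, if_false]; exact continuous_const.sub (continuous_coe_weight_apply e)

/-- The random-cluster weight of a fixed configuration is continuous in the parameters. [cite: Grimmett2006, §4.5 (Thm. (4.63))] -/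
theorem rcWeightW_continuous (q : ℝ) (B : Set V) (ω : BondConfig V) :
    Continuous fun w : Sym2 V → unitInterval => rcWeightW w q B ω :=
  (weight_continuous ω).mul continuous_const

/-- The partition function is continuous in the parameters. [cite: Grimmett2006, §4.5 (Thm. (4.63))] -/
theorem rcPartitionFunctionW_continuous (q : ℝ) (B : Set V) :
    Continuous fun w : Sym2 V → unitInterval => rcPartitionFunctionW w q B := by
  unfold rcPartitionFunctionW
  exact continuous_finsetSum _ fun ω _ => rcWeightW_continuous q B ω

/-- **Continuity of `𝐩 ↦ φ^B_{𝐩,q}(A)`** on `Sym2 V → [0,1]`, for `0 < q` and every event `A` (a ratio of polynomials in the parameters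
with positive denominator). [cite: Grimmett2006, §4.5 (Thm. (4.63))] -/
theorem rcMeasureW_real_continuous {q : ℝ} (hq : 0 < q) (B : Set V) (A : Set (BondConfig V)) :
    Continuous fun w : Sym2 V → unitInterval => (rcMeasureW w q B).real A := by
  have h : (fun w : Sym2 V → unitInterval => (rcMeasureW w q B).real A) =
      fun w => (∑ ω : BondConfig V, rcWeightW w q B ω * ind A ω) / rcPartitionFunctionW w q B :=
    funext fun w => rcMeasureW_real_eq_sum_div w hq B A
  rw [h]
  refine Continuous.div (continuous_finsetSum _ fun ω _ => (rcWeightW_continuous q B ω).mul continuous_const)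
    (rcPartitionFunctionW_continuous q B) fun w => (rcPartitionFunctionW_pos w hq B).ne'

/-- **Finite energy / non-degenerate parameters charge every configuration**: if `0 < p_e < 1` for every `e` and `0 < q`, every
nonempty event has positive `φ^B_{𝐩,q}`-probability. [cite: Grimmett2006, Thm. (3.1) eq. (3.4) (finite energy)] -/
theorem rcMeasureW_real_pos_of_nonempty {q : ℝ} (hq : 0 < q) {w : Sym2 V → unitInterval}
    (hw : ∀ e, 0 < w e ∧ w e < 1) (B : Set V) {A : Set (BondConfig V)} (hA : A.Nonempty) :
    0 < (rcMeasureW w q B).real A := by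
  obtain ⟨ω₀, hω₀⟩ := hA
  rw [rcMeasureW_real_eq_sum_div w hq B A]
  refine div_pos ?_ (rcPartitionFunctionW_pos w hq B)
  have hterm : ∀ ω, 0 ≤ rcWeightW w q B ω * ind A ω := fun ω =>
    mul_nonneg (rcWeightW_nonneg w hq.le B ω) (ind_nonneg A ω)
  have hpos : 0 < rcWeightW w q B ω₀ * ind A ω₀ := by
    rw [ind_of_mem hω₀, mul_one]
    unfold rcWeightW weight
    refine mul_pos (Finset.prod_pos fun e _ => ?_) (pow_pos hq _)
    have h0 : (0 : ℝ) < w e := (hw e).1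
    have h1 : (w e : ℝ) < 1 := (hw e).2
    split_ifs
    · exact h0
    · linarith
  exact lt_of_lt_of_le hpos (Finset.single_le_sum (fun ω _ => hterm ω) (Finset.mem_univ ω₀))

end Continuity

end Literature.Probability.LatticeModels

end
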